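import Mathlib
import Literature.Computability.Complexity.RangeAvoidance
import Literature.Computability.Complexity.SignDegreeSimple
import Literature.Computability.Complexity.SignDegreeXor

/-!
# The multigraph part of `P⋆ = x_a ⊕ x_b ⊕ x_c·x_d` range avoidance peels off to `IP₂`

Cell pnp-ideate (planner seat p3, ROUND-18 notes §F4; FRONTIER — a restricted-model reduction step; nothing
here bears on `P ≠ NP`).

Let `I` be a `4`-local map all of whose tables are `xorAndPred` (`u ↦ u₀ ⊕ u₁ ⊕ u₂·u₃`; repeated variables
allowed).  Two outputs `j ≠ j'` reading the SAME XOR slots (`vars j 0 = vars j' 0`, `vars j 1 = vars j' 1`)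
give the derived output `y_j ⊕ y_{j'} = x_{c}x_{d} ⊕ x_{c'}x_{d'}` — a `4`-local output with table `ipPred₂`
(sign-degree `2`, `signDeg_ipPred₂`).  A `Pairing` selects `m'` such pairs with injective first components
never reused as second components; `peel` is the derived `4`-local map (`peel_eval`), every table of which
has sign-degree `≤ 2` (`peel_signDegLE_two`, so it lies in the class of the ROUND-18 crux
`SignDeg2Signing.SignDeg2OnlyAvoidLinearFP 4`), and `lift` turns a point outside the derived range into a
point outside `Range I` (`lift_not_mem_range`: put `z_i` on the first output of pair `i`, `false` elsewhere).

Consequence (informal; the `IsPolyTime` bucketing is not typed here): `P⋆` instances with `≥ C'·n` disjoint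
repeated-XOR-pair pairs are solved at linear stretch by the sign-degree-`2` avoider of locality `4`; the
residual hard family has an (almost) SIMPLE XOR graph. [posed and proved in the cell, ROUND-18 notes §F4]
-/

set_option linter.dupNamespace false -- `Summit.PneNP.PneNP.…`: summit = sub-problem name (D-0017 single-conjunct layout)

namespace Summit.PneNP.PneNP.Theorems.PstarPairPeel

open Literature.Computability.Complexity

variable {n m m' : ℕ}

/-- A selection of `m'` output pairs `(fst i, snd i)` of `I` reading the same XOR slots, with injective
first components that are never second components. -/
structure Pairing (I : LocalMap 4 n m) (m' : ℕ) where
  /-- first output of pair `i` (carries the derived bit) -/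
  fst : Fin m' → Fin m
  /-- second output of pair `i` -/
  snd : Fin m' → Fin m
  /-- distinct pairs have distinct first outputs -/
  fst_injective : Function.Injective fst
  /-- no first output is a second output -/
  fst_ne_snd : ∀ i i', fst i ≠ snd i'
  /-- the two outputs read the same first XOR slot -/
  vars_zero : ∀ i, I.vars (fst i) 0 = I.vars (snd i) 0
  /-- the two outputs read the same second XOR slot -/
  vars_one : ∀ i, I.vars (fst i) 1 = I.vars (snd i) 1

/-- The derived `4`-local map: output `i` reads the two AND pairs of pair `i` and has table `IP₂`. -/
def peel (I : LocalMap 4 n m) (π : Pairing I m') : LocalMap 4 n m' where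
  vars i := ![I.vars (π.fst i) 2, I.vars (π.fst i) 3, I.vars (π.snd i) 2, I.vars (π.snd i) 3]
  table _ := ipPred₂

/-- Every table of the derived map is `IP₂`, of sign-degree `≤ 2`. -/
theorem peel_signDegLE_two (I : LocalMap 4 n m) (π : Pairing I m') (i : Fin m') :
    SignDegLE 2 ((peel I π).table i) :=
  signDeg_ipPred₂.1

/-- The derived output is the XOR of the two paired `P⋆` outputs (the common XOR part cancels). -/
theorem peel_eval (I : LocalMap 4 n m) (hI : ∀ j, I.table j = xorAndPred) (π : Pairing I m')
    (x : Fin n → Bool) (i : Fin m') :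
    (peel I π).eval x i = xor (I.eval x (π.fst i)) (I.eval x (π.snd i)) := by
  simp only [LocalMap.eval, peel, hI, xorAndPred_apply, ipPred₂_apply, π.vars_zero i, π.vars_one i]
  simp only [Matrix.cons_val_zero, Matrix.cons_val_one]
  have h2 : (![I.vars (π.fst i) 2, I.vars (π.fst i) 3, I.vars (π.snd i) 2, I.vars (π.snd i) 3] :
      Fin 4 → Fin n) 2 = I.vars (π.snd i) 2 := rfl
  have h3 : (![I.vars (π.fst i) 2, I.vars (π.fst i) 3, I.vars (π.snd i) 2, I.vars (π.snd i) 3] :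
      Fin 4 → Fin n) 3 = I.vars (π.snd i) 3 := rfl
  rw [h2, h3]
  generalize x (I.vars (π.snd i) 0) = a
  generalize x (I.vars (π.snd i) 1) = b
  generalize (x (I.vars (π.fst i) 2) && x (I.vars (π.fst i) 3)) = p
  generalize (x (I.vars (π.snd i) 2) && x (I.vars (π.snd i) 3)) = q
  cases a <;> cases b <;> cases p <;> cases q <;> rfl

open Classical in
/-- Lift a target for the derived map to a target for `I`: `z_i` on the first output of pair `i`,
`false` on every other output. -/
noncomputable def lift {I : LocalMap 4 n m} (π : Pairing I m') (z : Fin m' → Bool) (j : Fin m) : Bool :=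
  if h : ∃ i, π.fst i = j then z h.choose else false

/-- The lift carries `z_i` on the first output of pair `i`. -/
theorem lift_fst {I : LocalMap 4 n m} (π : Pairing I m') (z : Fin m' → Bool) (i : Fin m') :
    lift π z (π.fst i) = z i := by
  classical
  have h : ∃ i', π.fst i' = π.fst i := ⟨i, rfl⟩
  simp only [lift, dif_pos h]
  congr 1
  exact π.fst_injective h.choose_spec

/-- The lift is `false` on every second output. -/
theorem lift_snd {I : LocalMap 4 n m} (π : Pairing I m') (z : Fin m' → Bool) (i : Fin m') :
    lift π z (π.snd i) = false := by
  classical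
  have h : ¬ ∃ i', π.fst i' = π.snd i := fun ⟨i', e⟩ => π.fst_ne_snd i' i e
  simp only [lift, dif_neg h]

/-- **Peeling is sound.** If `z` is outside the range of the derived `IP₂` map, its lift is outside the
range of the `P⋆` map. -/
theorem lift_not_mem_range (I : LocalMap 4 n m) (hI : ∀ j, I.table j = xorAndPred) (π : Pairing I m')
    (z : Fin m' → Bool) (hz : z ∉ (peel I π).range) : lift π z ∉ I.range := by
  rintro ⟨x, hx⟩
  refine hz ⟨x, funext fun i => ?_⟩
  rw [peel_eval I hI π x i]
  have h₁ := congrFun hx (π.fst i)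
  have h₂ := congrFun hx (π.snd i)
  rw [lift_fst] at h₁
  rw [lift_snd] at h₂
  rw [h₁, h₂, Bool.xor_false]

/-- The reduction in one statement: an avoider for the derived sign-degree-`2` instance yields an avoider for
the `P⋆` instance on the selected pairs. -/
theorem pstar_avoid_of_peel_avoid (I : LocalMap 4 n m) (hI : ∀ j, I.table j = xorAndPred)
    (π : Pairing I m') (h : ∃ z, z ∉ (peel I π).range) : ∃ y, y ∉ I.range := by
  obtain ⟨z, hz⟩ := h
  exact ⟨lift π z, lift_not_mem_range I hI π z hz⟩

end Summit.PneNP.PneNP.Theorems.PstarPairPeel
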